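import Literature.MathematicalPhysics.QuantumLattice.HubbardTorusPlaquetteDressedBound
import HarnessLib

/-!
# The two plaquette charts of a link window are sign-free tensor embeddings

Topic `MathematicalPhysics/QuantumLattice`, family `hubbard`; companion of
`HubbardTorusPlaquetteDressedBound.lean`. The link window `{0,1} × {0,1}²` of the plaquette tiling
carries the two charts `inlCell a = (0, a)` and `inrCell a = (1, a)`; the dressed-cluster bound uses
the two-cell dressing `V = Γ(inlCell) u · Γ(inrCell) u'`. Because every orbital of copy `0`
precedes every orbital of copy `1` in the Jordan–Wigner order of the window
(`Orb (Fin 2 ×ₗ Λ₀)`, site-major), the second quantisations of the two charts are the plain tensor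
embeddings — no Jordan–Wigner signs:

* `fermionEmbed_inlCell_apply` — `(Γ(inlCell) u)_{S,T} = [S₁ = T₁] · u_{S₀,T₀}` for EVERY operator
  `u` of the plaquette (copy `0` is an initial segment);
* `fermionEmbed_inrCell_apply` — `(Γ(inrCell) u)_{S,T} = [S₀ = T₀] · u_{S₁,T₁}` for every `u`
  commuting with the particle number (copy `1` is a final segment; the environment sign
  `(-1)^{|S₀|(|S₁|+|T₁|)}` is `+1` on the support of such `u`).

Here `S₀ = JWEmbed.pre (orbEmb ·) S` is the part of the window configuration `S` in the chart,
pulled back to the plaquette, and `S₁ = JWEmbed.env (orbEmb ·) S` the part outside the chart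
(`FermionEmbedding.lean`). Bratteli–Robinson II §5.2.2, Thm 5.2.5 (Jordan–Wigner form of the
isotony maps). Everything is proved; the two definitions (`inlCellO`, `inrCellO`, the charts as
ORDER embeddings) have bodies; no named facts.
-/

noncomputable section

namespace Literature.MathematicalPhysics.QuantumLattice

open Matrix Finset HubbardWave0 JWEmbed
open scoped symmDiff

namespace PlaquetteLUC

/-- The first plaquette chart of a link window as an ORDER embedding. [folklore] -/
def inlCellO : FermionTorus 2 2 ↪o Fin 2 ×ₗ FermionTorus 2 2 :=
  OrderEmbedding.ofStrictMono (fun a => toLex ((0 : Fin 2), a)) fun _ _ h =>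
    Prod.Lex.lt_iff.2 (Or.inr ⟨rfl, h⟩)

/-- The second plaquette chart of a link window as an ORDER embedding. [folklore] -/
def inrCellO : FermionTorus 2 2 ↪o Fin 2 ×ₗ FermionTorus 2 2 :=
  OrderEmbedding.ofStrictMono (fun a => toLex ((1 : Fin 2), a)) fun _ _ h =>
    Prod.Lex.lt_iff.2 (Or.inr ⟨rfl, h⟩)

/-- `inlCellO a = (0, a)`. [folklore] -/
@[simp] theorem inlCellO_apply (a : FermionTorus 2 2) : inlCellO a = toLex (0, a) := rfl

/-- `inrCellO a = (1, a)`. [folklore] -/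
@[simp] theorem inrCellO_apply (a : FermionTorus 2 2) : inrCellO a = toLex (1, a) := rfl

/-- `inlCell` is the order embedding `inlCellO`. [folklore] -/
theorem inlCell_eq : inlCell = inlCellO.toEmbedding := by
  ext a : 1; rfl

/-- `inrCell` is the order embedding `inrCellO`. [folklore] -/
theorem inrCell_eq : inrCell = inrCellO.toEmbedding := by
  ext a : 1; rfl

/-- The copy index of the site of a window orbital. [folklore] -/
theorem ofLex_fst_eq_zero_or_one (j : Orb (Fin 2 ×ₗ FermionTorus 2 2)) :
    (ofLex (ofLex j).1).1 = 0 ∨ (ofLex (ofLex j).1).1 = 1 := by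
  rcases Fin.eq_zero_or_eq_succ (ofLex (ofLex j).1).1 with h | ⟨k, hk⟩
  · exact Or.inl h
  · right; rw [hk, Fin.eq_zero k]; rfl

/-- An orbital over a copy-`i` site is the image of a plaquette orbital under the chart of copy `i`.
[folklore] -/
theorem eq_orb_of_fst_eq (j : Orb (Fin 2 ×ₗ FermionTorus 2 2)) (i : Fin 2) (h : (ofLex (ofLex j).1).1 = i) :
    j = orb (toLex (i, (ofLex (ofLex j).1).2)) (ofLex j).2 := by
  rw [← h]
  change j = toLex (toLex (ofLex (ofLex j).1), (ofLex j).2)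
  rw [toLex_ofLex, Prod.mk.eta, toLex_ofLex]

/-- Orbitals outside the first chart lie over copy `1`, hence ABOVE every orbital of the chart.
[folklore] -/
theorem lt_of_not_mem_rangeF_inl {j : Orb (Fin 2 ×ₗ FermionTorus 2 2)} (hj : j ∉ rangeF (orbEmb inlCellO))
    (i : Orb (FermionTorus 2 2)) : orbEmb inlCellO i < j := by
  have h1 : (ofLex (ofLex j).1).1 = 1 := by
    rcases ofLex_fst_eq_zero_or_one j with h | h
    · exfalso; apply hj
      rw [mem_rangeF]
      exact ⟨orb (ofLex (ofLex j).1).2 (ofLex j).2, by rw [orbEmb_orb, inlCellO_apply]; exact (eq_orb_of_fst_eq j 0 h).symm⟩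
    · exact h
  rw [eq_orb_of_fst_eq j 1 h1, show orbEmb inlCellO i = orb (toLex (0, (ofLex i).1)) (ofLex i).2 from rfl]
  exact Prod.Lex.lt_iff.2 (Or.inl (Prod.Lex.lt_iff.2 (Or.inl (show (0 : Fin 2) < 1 by decide))))

/-- Orbitals outside the second chart lie over copy `0`, hence BELOW every orbital of the chart.
[folklore] -/
theorem lt_of_not_mem_rangeF_inr {j : Orb (Fin 2 ×ₗ FermionTorus 2 2)} (hj : j ∉ rangeF (orbEmb inrCellO))
    (i : Orb (FermionTorus 2 2)) : j < orbEmb inrCellO i := by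
  have h0 : (ofLex (ofLex j).1).1 = 0 := by
    rcases ofLex_fst_eq_zero_or_one j with h | h
    · exact h
    · exfalso; apply hj
      rw [mem_rangeF]
      exact ⟨orb (ofLex (ofLex j).1).2 (ofLex j).2, by rw [orbEmb_orb, inrCellO_apply]; exact (eq_orb_of_fst_eq j 1 h).symm⟩
  rw [eq_orb_of_fst_eq j 0 h0, show orbEmb inrCellO i = orb (toLex (1, (ofLex i).1)) (ofLex i).2 from rfl]
  exact Prod.Lex.lt_iff.2 (Or.inl (Prod.Lex.lt_iff.2 (Or.inl (show (0 : Fin 2) < 1 by decide))))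

/-- The environment signs of the first chart are trivial. [folklore] -/
theorem transSign_env_inl (S : Finset (Orb (Fin 2 ×ₗ FermionTorus 2 2))) (X : Finset (Orb (FermionTorus 2 2))) :
    transSign (orbEmb inlCellO) (env (orbEmb inlCellO) S) X = 1 := by
  refine Finset.prod_eq_one fun i _ => ?_
  rw [envSign, Finset.filter_eq_empty_iff.2, card_empty, pow_zero]
  intro j hj hlt
  exact lt_asymm hlt (lt_of_not_mem_rangeF_inl (mem_env.1 hj).2 i)

/-- The environment signs of the second chart: every environment orbital lies below the chart, so
`transSign r X = (-1)^{|r| |X|}`. [folklore] -/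
theorem transSign_env_inr (S : Finset (Orb (Fin 2 ×ₗ FermionTorus 2 2))) (X : Finset (Orb (FermionTorus 2 2))) :
    transSign (orbEmb inrCellO) (env (orbEmb inrCellO) S) X =
      ((-1 : ℂ) ^ (env (orbEmb inrCellO) S).card) ^ X.card := by
  rw [transSign, Finset.prod_eq_pow_card]
  intro i _
  rw [envSign, Finset.filter_true_of_mem]
  intro j hj
  exact lt_of_not_mem_rangeF_inr (mem_env.1 hj).2 i

/-- **`Γ(inlCell) u = u ⊗ 1`**: the matrix of the first chart's second quantisation is
`(Γ(inlCell) u)_{S,T} = [S₁ = T₁] u_{S₀,T₀}` (copy-`0` parts pulled back to the plaquette, copy-`1`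
parts equal), for every operator `u`. [cite: BratteliRobinsonII1997, §5.2.2, Thm. 5.2.5] -/
theorem fermionEmbed_inlCell_apply (u : Matrix (Finset (Orb (FermionTorus 2 2))) (Finset (Orb (FermionTorus 2 2))) ℂ)
    (S T : Finset (Orb (Fin 2 ×ₗ FermionTorus 2 2))) :
    fermionEmbed inlCell u S T =
      if env (orbEmb inlCellO) S = env (orbEmb inlCellO) T then
        u (pre (orbEmb inlCellO) S) (pre (orbEmb inlCellO) T) else 0 := by
  rw [inlCell_eq, fermionEmbed_orderEmbedding, jwEmbed_apply, embedFun_apply, transSign_env_inl, mul_one]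

/-- **`Γ(inrCell) u = 1 ⊗ u` for particle-number conserving `u`**:
`(Γ(inrCell) u)_{S,T} = [S₀ = T₀] u_{S₁,T₁}` (the environment sign `(-1)^{|S₀|(|S₁|+|T₁|)}` equals
`+1` wherever `u_{S₁,T₁} ≠ 0`, since then `|S₁| = |T₁|`). [cite: BratteliRobinsonII1997, §5.2.2, Thm. 5.2.5] -/
theorem fermionEmbed_inrCell_apply (u : Matrix (Finset (Orb (FermionTorus 2 2))) (Finset (Orb (FermionTorus 2 2))) ℂ)
    (huN : Commute totalNumberOp u) (S T : Finset (Orb (Fin 2 ×ₗ FermionTorus 2 2))) :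
    fermionEmbed inrCell u S T =
      if env (orbEmb inrCellO) S = env (orbEmb inrCellO) T then
        u (pre (orbEmb inrCellO) S) (pre (orbEmb inrCellO) T) else 0 := by
  rw [inrCell_eq, fermionEmbed_orderEmbedding, jwEmbed_apply, embedFun_apply]
  split_ifs with h
  · by_cases hc : (pre (orbEmb inrCellO) S).card = (pre (orbEmb inrCellO) T).card
    · have hsq : ∀ n k : ℕ, (((-1 : ℂ) ^ n) ^ k) * (((-1 : ℂ) ^ n) ^ k) = 1 := by
        intro n k
        rw [← pow_two, ← pow_mul, ← pow_mul]
        exact Even.neg_one_pow ⟨n * k, by ring⟩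
      rw [← transSign_mul_transSign, transSign_env_inr, transSign_env_inr, hc, hsq, mul_one]
    · rw [apply_eq_zero_of_commute_totalNumberOp huN hc, zero_mul]
  · rfl

end PlaquetteLUC

end Literature.MathematicalPhysics.QuantumLattice
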